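import Summits.Ventures.LatticeQCDFlow.Scaling.IdealStarThreeTermLaw

/-!
HONEST FRAMING: exact (Metropolis-corrected) sampling algorithms for lattice gauge theory; figures
of merit are autocorrelation/cost numbers at stated couplings and volumes; no continuum-physics
claim.

# UnitSurvivalPotential — IN THE IDEALISED HOT-ONLY STAR A RARE VALUE PLANTED AT A COLD LEVEL SURVIVES: THE
# THREE-VALUED POTENTIAL `Ψ_s` (`1` IF A COLD LEVEL HOLDS `s`, `t` IF ONLY THE HUB DOES, `0` OTHERWISE) IS A
# MULTIPLICATIVE SUBMARTINGALE, `PΨ_s ≥ (1 − t(1−t)ĉ/m)·Ψ_s` (`ĉ` THE LARGEST HUB MULTIPLICITY), HENCE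
# `E_x Ψ_s(X_n) ≥ (1 − t(1−t)ĉ/m)ⁿ·Ψ_s(x)` (lean-2 GEN-27, ours)

Venture-side (OURS).  Cell `lqcd-flow` (pub-lqcd), unit `pub-lqcd-lean-2-g27`, 2026-08-27.  Chapter M, the floor side
(`HOME/lean-2/OPEN-MATH-chapterM.md` item 2, first-moment part).  THE SCHEME is the idealised hot-only star of
`Scaling/IdealStarThreeTermLaw`: one positive unit-mass law `ν` at every level, hub list `e_r = (0, κ_r+1)` with
`m ≥ 1` entries and multiplicities `#{r : κ_r = p'} ≤ ĉ`, identity maps (so every swap is accepted), swap fraction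
`t`, hot-only single-site updates with a `ν`-reversible hot kernel `M_0` (exactness NOT needed):
`P = t·GSw + (1−t)·coordKernel M 0`.  THE POTENTIAL of a state `s`:
`Ψ_s(z) = 1` if some COLD level holds `s`, `= t` if only the hub holds `s`, `= 0` otherwise.  A cold copy is lost
only when it is the last one and a swap carries it to a hub not holding `s` (probability `≤ tĉ/m`, new value `t`);
a hub-only copy is carried to a cold level by every swap (probability `t`, new value `1`) and otherwise refreshed;
so `PΨ_s ≥ (1 − t(1−t)ĉ/m)·Ψ_s` — a multiplicative submartingale whose rate is the product of the escape rate from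
the hub `1−t` and the capture rate `tĉ/m`.

## What is proved

* §1 the potential: `survPot_nonneg`, `survPot_le_one`, `survPot_le_indicator`, `survPot_swap_ge`
  (`Ψ(swap_r y) ≥ 1 − (1−t)·𝟙{the only cold copy sits at κ_r+1}` when a cold copy exists), `onlyCopy_count_le`
  (at most `ĉ` entries see the only cold copy), `survPot_swap_of_hubOnly`.
* §2 one step: `ideal_swapMean` (`Σ_z GSw(y,z)F(z) = (1/m)Σ_r F(swap_r y)`), `hotOnly_updateMean`,
  **`scheme_survPot_ge`** (`Σ_z P(y,z)Ψ(z) ≥ (1 − t(1−t)ĉ/m)·Ψ(y)`).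
* §3 **`scheme_lawAt_survPot_ge`** (`E_x Ψ(X_n) ≥ (1 − t(1−t)ĉ/m)ⁿ·Ψ(x)`, by the multiplicative drift lemma of
  `Scaling/DirtySetDecay` applied to `−Ψ`).

Reading (no numerics implied): the rate is the PRODUCT of the capture rate of the last cold copy by the hub
(`≤ tĉ/m` per step) and the probability `1−t` that the hub then refreshes before any swap carries the value back
out — the mechanism behind the unit `m/(t(1−t)ĉ)`; the sequel `Scaling/UnitSurvivalFloor` turns it into
`d(n) ≥ (1 − t(1−t)ĉ/m)ⁿ − (K+1)ν(s)` and `t_mix(1/4) ≥ (K/(t(1−t)) − 1)·log 2` at uniform listing.  NOT CLAIMED: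
flow-assisted or rejected swaps (a non-identity map or a rejection changes the bookkeeping); anything measured.
Literature grade (cell rule): OWN RESULT; nothing cited as a fact; no new bib keys.
-/

noncomputable section

open Finset Function
open Literature.Probability.MarkovChains

namespace Summit.Ventures.LatticeQCDFlow.Scaling

variable {S : Type*} [Fintype S] [DecidableEq S] {K m : ℕ} {ν : S → ℝ} {M : Fin (K + 1) → S → S → ℝ} {t : ℝ}

section Survival
variable (κ : Fin m → Fin K)

/-! ## §1 The survival potential -/

omit [Fintype S] in
/-- `Ψ ≥ 0` (`t ≥ 0`). [ours] -/
theorem survPot_nonneg (ht0 : 0 ≤ t) (s : S) {Ψ : (Fin (K + 1) → S) → ℝ}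
    (hΨ : ∀ z, Ψ z = if (∃ k : Fin K, z k.succ = s) then (1 : ℝ) else (if z 0 = s then t else 0))
    (z : Fin (K + 1) → S) : 0 ≤ Ψ z := by
  rw [hΨ]; split_ifs <;> linarith

omit [Fintype S] in
/-- `Ψ ≤ 1` (`t ≤ 1`). [ours] -/
theorem survPot_le_one (ht1 : t ≤ 1) (s : S) {Ψ : (Fin (K + 1) → S) → ℝ}
    (hΨ : ∀ z, Ψ z = if (∃ k : Fin K, z k.succ = s) then (1 : ℝ) else (if z 0 = s then t else 0))
    (z : Fin (K + 1) → S) : Ψ z ≤ 1 := by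
  rw [hΨ]; split_ifs <;> linarith

omit [Fintype S] in
/-- **`Ψ_s ≤ 𝟙{∃ k, z_k = s}`** (`0 ≤ t ≤ 1`). [ours] -/
theorem survPot_le_indicator (ht1 : t ≤ 1) (s : S) {Ψ : (Fin (K + 1) → S) → ℝ}
    (hΨ : ∀ z, Ψ z = if (∃ k : Fin K, z k.succ = s) then (1 : ℝ) else (if z 0 = s then t else 0))
    (z : Fin (K + 1) → S) :
    Ψ z ≤ if (∃ k ∈ (univ : Finset (Fin (K + 1))), z k = (fun _ : Fin (K + 1) => s) k) then (1 : ℝ) else 0 := by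
  rw [hΨ]
  by_cases hc : ∃ k : Fin K, z k.succ = s
  · obtain ⟨k, hk⟩ := hc
    rw [if_pos ⟨k, hk⟩, if_pos ⟨k.succ, mem_univ _, hk⟩]
  · rw [if_neg hc]
    by_cases h0 : z 0 = s
    · rw [if_pos h0, if_pos ⟨0, mem_univ _, h0⟩]; exact ht1
    · rw [if_neg h0]; split_ifs <;> norm_num

omit [Fintype S] [DecidableEq S] in
/-- With the identity map the hub swap reads `(swap_r y)_0 = y_{κ_r+1}`, `(swap_r y)_{κ_r+1} = y_0`, other coordinates
unchanged. [ours] -/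
theorem hubSwap_apply (r : Fin m) (y : Fin (K + 1) → S) :
    edgeFlowSwap (Equiv.refl S) 0 (κ r).succ y 0 = y (κ r).succ ∧
      edgeFlowSwap (Equiv.refl S) 0 (κ r).succ y (κ r).succ = y 0 ∧
      ∀ k : Fin K, k ≠ κ r → edgeFlowSwap (Equiv.refl S) 0 (κ r).succ y k.succ = y k.succ := by
  refine ⟨?_, ?_, fun k hk => ?_⟩
  · rw [edgeFlowSwap_refl_apply, Equiv.swap_apply_left]
  · rw [edgeFlowSwap_refl_apply, Equiv.swap_apply_right]
  · rw [edgeFlowSwap_refl_apply, Equiv.swap_apply_of_ne_of_ne (Fin.succ_ne_zero k)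
      (fun h => hk (Fin.succ_injective _ h))]

omit [Fintype S] in
/-- **A SWAP COSTS AT MOST `1 − t`, AND ONLY WHEN IT CARRIES THE LAST COLD COPY TO THE HUB:** if some cold level holds
`s`, then `Ψ(swap_r y) ≥ 1 − (1−t)·𝟙{y_{κ_r+1} = s ∧ no other cold level holds s}` (`0 ≤ t ≤ 1`). [ours] -/
theorem survPot_swap_ge (ht1 : t ≤ 1) (s : S) {Ψ : (Fin (K + 1) → S) → ℝ}
    (hΨ : ∀ z, Ψ z = if (∃ k : Fin K, z k.succ = s) then (1 : ℝ) else (if z 0 = s then t else 0))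
    (r : Fin m) (y : Fin (K + 1) → S) (hy : ∃ k : Fin K, y k.succ = s) :
    1 - (1 - t) * (if (y (κ r).succ = s ∧ ∀ k : Fin K, k ≠ κ r → y k.succ ≠ s) then (1 : ℝ) else 0)
      ≤ Ψ (edgeFlowSwap (Equiv.refl S) 0 (κ r).succ y) := by
  obtain ⟨h0, hl, hoff⟩ := hubSwap_apply κ r y
  by_cases hother : ∃ k : Fin K, k ≠ κ r ∧ y k.succ = s
  · -- another cold copy survives the swap
    obtain ⟨k, hk, hks⟩ := hother
    have hcold : ∃ k' : Fin K, edgeFlowSwap (Equiv.refl S) 0 (κ r).succ y k'.succ = s := ⟨k, by rw [hoff k hk, hks]⟩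
    rw [hΨ, if_pos hcold]
    split_ifs <;> nlinarith
  · -- the only cold copy sits at `κ_r + 1`; after the swap the hub holds `s`
    push Not at hother
    obtain ⟨k₀, hk₀⟩ := hy
    have hkr : k₀ = κ r := by
      by_contra h; exact hother k₀ h hk₀
    subst hkr
    rw [if_pos ⟨hk₀, fun k hk => hother k hk⟩, mul_one]
    have hhub : edgeFlowSwap (Equiv.refl S) 0 (κ r).succ y 0 = s := by rw [h0, hk₀]
    rw [hΨ]
    split_ifs <;> linarith

omit [Fintype S] in
/-- **AT MOST `ĉ` ENTRIES SEE THE ONLY COLD COPY:** if some cold level holds `s` and `#{r : κ_r = p'} ≤ ĉ` for all `p'`,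
then `Σ_r 𝟙{y_{κ_r+1} = s ∧ no other cold level holds s} ≤ ĉ`. [ours] -/
theorem onlyCopy_count_le {cmax : ℕ} (hc : ∀ p' : Fin K, (univ.filter (fun r : Fin m => κ r = p')).card ≤ cmax)
    (s : S) (y : Fin (K + 1) → S) (hy : ∃ k : Fin K, y k.succ = s) :
    ∑ r : Fin m, (if (y (κ r).succ = s ∧ ∀ k : Fin K, k ≠ κ r → y k.succ ≠ s) then (1 : ℝ) else 0) ≤ cmax := by
  obtain ⟨k₀, hk₀⟩ := hy
  calc ∑ r : Fin m, (if (y (κ r).succ = s ∧ ∀ k : Fin K, k ≠ κ r → y k.succ ≠ s) then (1 : ℝ) else 0)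
      ≤ ∑ r : Fin m, (if κ r = k₀ then (1 : ℝ) else 0) := by
        refine sum_le_sum fun r _ => ?_
        by_cases h : y (κ r).succ = s ∧ ∀ k : Fin K, k ≠ κ r → y k.succ ≠ s
        · have : κ r = k₀ := by
            by_contra hne; exact h.2 k₀ (Ne.symm hne) hk₀
          rw [if_pos h, if_pos this]
        · rw [if_neg h]; split_ifs <;> norm_num
    _ = ((univ.filter (fun r : Fin m => κ r = k₀)).card : ℝ) := by
        rw [Finset.card_filter, Nat.cast_sum]; simp only [Nat.cast_ite, Nat.cast_one, Nat.cast_zero]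
    _ ≤ cmax := by exact_mod_cast hc k₀

omit [Fintype S] in
/-- **A HUB-ONLY COPY IS CARRIED TO A COLD LEVEL BY EVERY SWAP:** `y_0 = s` ⇒ `Ψ(swap_r y) = 1`. [ours] -/
theorem survPot_swap_of_hubOnly (s : S) {Ψ : (Fin (K + 1) → S) → ℝ}
    (hΨ : ∀ z, Ψ z = if (∃ k : Fin K, z k.succ = s) then (1 : ℝ) else (if z 0 = s then t else 0))
    (r : Fin m) (y : Fin (K + 1) → S) (hy0 : y 0 = s) : Ψ (edgeFlowSwap (Equiv.refl S) 0 (κ r).succ y) = 1 := by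
  obtain ⟨_, hl, _⟩ := hubSwap_apply κ r y
  rw [hΨ, if_pos ⟨κ r, by rw [hl, hy0]⟩]

/-! ## §2 One step of the idealised hot-only star -/

/-- **Integrating against the ideal star's swap:** `Σ_z GSw(y,z)·F(z) = (1/m)·Σ_r F(swap_r y)` (`ν > 0`, `m ≥ 1`).
[ours] -/
theorem ideal_swapMean (hm : 1 ≤ m) (hν : ∀ v, 0 < ν v) (F : (Fin (K + 1) → S) → ℝ) (y : Fin (K + 1) → S) :
    ∑ z, ptGraphSwap (fun _ : Fin (K + 1) => ν)
        (fun r : Fin m => (((0 : Fin (K + 1)), (κ r).succ) : Fin (K + 1) × Fin (K + 1))) (fun _ => Equiv.refl S) y z * F z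
      = (1 / (m : ℝ)) * ∑ r : Fin m, F (edgeFlowSwap (Equiv.refl S) 0 (κ r).succ y) := by
  simp_rw [ptGraphSwap_eq_proposal_of_const κ hm hν]
  unfold ptGraphProposal
  simp_rw [Finset.sum_mul]
  rw [Finset.sum_comm, Finset.mul_sum]
  refine sum_congr rfl fun r _ => ?_
  simp_rw [ite_mul, zero_mul]
  rw [Finset.sum_ite_eq' univ (edgeFlowSwap (Equiv.refl S) 0 (κ r).succ y), if_pos (mem_univ _)]

/-- **Integrating against the hot-only update:** `Σ_z Π(y,z)·F(z) = Σ_v M_0(y_0, v)·F(y[0 ↦ v])`. [ours] -/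
theorem hotOnly_updateMean (F : (Fin (K + 1) → S) → ℝ) (y : Fin (K + 1) → S) :
    ∑ z, prodKernel (fun k : Fin (K + 1) => if k = 0 then (1 : ℝ) else 0) M y z * F z
      = ∑ v, M 0 (y 0) v * F (update y 0 v) := by
  simp_rw [prodKernel_hotOnly]
  exact sum_coordKernel_mul M 0 y F

/-- **THE ONE-STEP SUBMARTINGALE: `Σ_z P(y,z)Ψ_s(z) ≥ (1 − t(1−t)ĉ/m)·Ψ_s(y)`** for the idealised hot-only star
(`0 ≤ t ≤ 1`, `m ≥ 1`, multiplicities `≤ ĉ`, `M_0` row-stochastic). [ours] -/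
theorem scheme_survPot_ge (hm : 1 ≤ m) (ht0 : 0 ≤ t) (ht1 : t ≤ 1) (hν : ∀ v, 0 < ν v) (hM : ∀ k, IsRowStochastic (M k))
    {cmax : ℕ} (hc : ∀ p' : Fin K, (univ.filter (fun r : Fin m => κ r = p')).card ≤ cmax)
    (s : S) {Ψ : (Fin (K + 1) → S) → ℝ}
    (hΨ : ∀ z, Ψ z = if (∃ k : Fin K, z k.succ = s) then (1 : ℝ) else (if z 0 = s then t else 0))
    (y : Fin (K + 1) → S) :
    (1 - t * (1 - t) * cmax / m) * Ψ y
      ≤ ∑ z, (t * ptGraphSwap (fun _ : Fin (K + 1) => ν)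
          (fun r : Fin m => (((0 : Fin (K + 1)), (κ r).succ) : Fin (K + 1) × Fin (K + 1))) (fun _ => Equiv.refl S) y z
        + (1 - t) * prodKernel (fun k : Fin (K + 1) => if k = 0 then (1 : ℝ) else 0) M y z) * Ψ z := by
  have hmpos : (0 : ℝ) < m := Nat.cast_pos.mpr (by omega)
  have hsplit : ∑ z, (t * ptGraphSwap (fun _ : Fin (K + 1) => ν)
          (fun r : Fin m => (((0 : Fin (K + 1)), (κ r).succ) : Fin (K + 1) × Fin (K + 1))) (fun _ => Equiv.refl S) y z
        + (1 - t) * prodKernel (fun k : Fin (K + 1) => if k = 0 then (1 : ℝ) else 0) M y z) * Ψ z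
      = t * ((1 / (m : ℝ)) * ∑ r : Fin m, Ψ (edgeFlowSwap (Equiv.refl S) 0 (κ r).succ y))
        + (1 - t) * ∑ v, M 0 (y 0) v * Ψ (update y 0 v) := by
    rw [← ideal_swapMean κ hm hν Ψ y, ← hotOnly_updateMean (M := M) Ψ y, Finset.mul_sum, Finset.mul_sum,
      ← Finset.sum_add_distrib]
    exact sum_congr rfl fun z _ => by ring
  rw [hsplit]
  have hΨ0 := survPot_nonneg ht0 s hΨ
  by_cases hcold : ∃ k : Fin K, y k.succ = s
  · -- case A: a cold copy; swaps cost at most `(1−t)ĉ/m`, the hot update nothing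
    have hΨy : Ψ y = 1 := by rw [hΨ, if_pos hcold]
    have hswap : (m : ℝ) - (1 - t) * cmax ≤ ∑ r : Fin m, Ψ (edgeFlowSwap (Equiv.refl S) 0 (κ r).succ y) := by
      have h1 := sum_le_sum fun r (_ : r ∈ (univ : Finset (Fin m))) => survPot_swap_ge κ ht1 s hΨ r y hcold
      rw [Finset.sum_sub_distrib, sum_const, card_univ, Fintype.card_fin, nsmul_eq_mul, mul_one, ← Finset.mul_sum] at h1
      have h2 := mul_le_mul_of_nonneg_left (onlyCopy_count_le κ hc s y hcold) (by linarith : (0 : ℝ) ≤ 1 - t)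
      linarith
    have hupd : ∑ v, M 0 (y 0) v * Ψ (update y 0 v) = 1 := by
      have hΨv : ∀ v, Ψ (update y 0 v) = 1 := fun v => by
        obtain ⟨k, hk⟩ := hcold
        rw [hΨ, if_pos ⟨k, by rw [update_of_ne (Fin.succ_ne_zero k), hk]⟩]
      simp_rw [hΨv, mul_one]
      exact (hM 0).2 (y 0)
    rw [hΨy, hupd, mul_one]
    have h3 : t * (1 - (1 - t) * cmax / m) ≤ t * ((1 / (m : ℝ)) * ∑ r : Fin m, Ψ (edgeFlowSwap (Equiv.refl S) 0 (κ r).succ y)) := by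
      refine mul_le_mul_of_nonneg_left ?_ ht0
      rw [show 1 - (1 - t) * (cmax : ℝ) / m = (1 / (m : ℝ)) * ((m : ℝ) - (1 - t) * cmax) by field_simp]
      exact mul_le_mul_of_nonneg_left hswap (by positivity)
    have e : 1 - t * (1 - t) * (cmax : ℝ) / m = t * (1 - (1 - t) * cmax / m) + (1 - t) * 1 := by ring
    rw [e]
    linarith
  · by_cases h0 : y 0 = s
    · -- case B: the hub only; every swap rescues, the hot update may kill
      have hΨy : Ψ y = t := by rw [hΨ, if_neg hcold, if_pos h0]
      have hswap : ∑ r : Fin m, Ψ (edgeFlowSwap (Equiv.refl S) 0 (κ r).succ y) = m := by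
        rw [sum_congr rfl fun r _ => survPot_swap_of_hubOnly κ s hΨ r y h0, sum_const, card_univ, Fintype.card_fin,
          nsmul_eq_mul, mul_one]
      have hupd : 0 ≤ ∑ v, M 0 (y 0) v * Ψ (update y 0 v) :=
        sum_nonneg fun v _ => mul_nonneg ((hM 0).1 _ _) (hΨ0 _)
      rw [hΨy, hswap, one_div_mul_cancel hmpos.ne', mul_one]
      have hlam0 : 0 ≤ t * (1 - t) * (cmax : ℝ) / m :=
        div_nonneg (mul_nonneg (mul_nonneg ht0 (by linarith)) (Nat.cast_nonneg _)) (Nat.cast_nonneg _)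
      nlinarith
    · -- case C: no copy at all
      have hΨy : Ψ y = 0 := by rw [hΨ, if_neg hcold, if_neg h0]
      rw [hΨy, mul_zero]
      exact add_nonneg (mul_nonneg ht0 (mul_nonneg (by positivity) (sum_nonneg fun r _ => hΨ0 _)))
        (mul_nonneg (by linarith) (sum_nonneg fun v _ => mul_nonneg ((hM 0).1 _ _) (hΨ0 _)))

/-! ## §3 `n` steps, the separating event, the floor -/

/-- **`E_x Ψ_s(X_n) ≥ (1 − t(1−t)ĉ/m)ⁿ·Ψ_s(x)`** for the idealised hot-only star. [ours] -/
theorem scheme_lawAt_survPot_ge (hm : 1 ≤ m) (ht0 : 0 ≤ t) (ht1 : t ≤ 1) (hν : ∀ v, 0 < ν v)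
    (hM : ∀ k, IsRowStochastic (M k))
    {cmax : ℕ} (hc : ∀ p' : Fin K, (univ.filter (fun r : Fin m => κ r = p')).card ≤ cmax) (hcm : cmax ≤ m)
    (s : S) {Ψ : (Fin (K + 1) → S) → ℝ}
    (hΨ : ∀ z, Ψ z = if (∃ k : Fin K, z k.succ = s) then (1 : ℝ) else (if z 0 = s then t else 0))
    (x : Fin (K + 1) → S) (n : ℕ) :
    (1 - t * (1 - t) * cmax / m) ^ n * Ψ x
      ≤ lawMean (lawAt (fun y z : Fin (K + 1) → S => t * ptGraphSwap (fun _ : Fin (K + 1) => ν)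
          (fun r : Fin m => (((0 : Fin (K + 1)), (κ r).succ) : Fin (K + 1) × Fin (K + 1))) (fun _ => Equiv.refl S) y z
        + (1 - t) * prodKernel (fun k : Fin (K + 1) => if k = 0 then (1 : ℝ) else 0) M y z) (Pi.single x 1) n) Ψ := by
  have hμ : ∀ (k : Fin (K + 1)) (v : S), 0 < (fun _ : Fin (K + 1) => ν) k v := fun _ v => hν v
  have hw0 : ∀ k : Fin (K + 1), 0 ≤ (if k = 0 then (1 : ℝ) else 0) := fun k => by split_ifs <;> norm_num
  have hw1 : ∑ k : Fin (K + 1), (if k = 0 then (1 : ℝ) else 0) = 1 := by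
    rw [Finset.sum_ite_eq' univ (0 : Fin (K + 1)), if_pos (mem_univ _)]
  have hP := weightedScheme_isRowStochastic (t := t) (w := fun k : Fin (K + 1) => if k = 0 then (1 : ℝ) else 0)
    (ptGraphSwap_isRowStochastic (e := fun r : Fin m => (((0 : Fin (K + 1)), (κ r).succ) : Fin (K + 1) × Fin (K + 1)))
      (φ := fun _ => Equiv.refl S) hμ) hM hw0 hw1 ht0 ht1
  have hmpos : (0 : ℝ) < m := Nat.cast_pos.mpr (by omega)
  have hlamle : 0 ≤ 1 - t * (1 - t) * (cmax : ℝ) / m := by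
    rw [sub_nonneg, div_le_one hmpos]
    have hcm' : (cmax : ℝ) ≤ m := by exact_mod_cast hcm
    have h1 : t * (1 - t) ≤ 1 := by nlinarith
    have h2 : 0 ≤ t * (1 - t) := mul_nonneg ht0 (by linarith)
    nlinarith
  -- the multiplicative drift lemma of `Scaling/DirtySetDecay`, applied to `−Ψ`
  have hstep : ∀ y, ∑ z, (t * ptGraphSwap (fun _ : Fin (K + 1) => ν)
      (fun r : Fin m => (((0 : Fin (K + 1)), (κ r).succ) : Fin (K + 1) × Fin (K + 1))) (fun _ => Equiv.refl S) y z
        + (1 - t) * prodKernel (fun k : Fin (K + 1) => if k = 0 then (1 : ℝ) else 0) M y z) * (-Ψ z)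
      ≤ (1 - t * (1 - t) * cmax / m) * (-Ψ y) := fun y => by
    have h := scheme_survPot_ge κ hm ht0 ht1 hν hM hc s hΨ y
    simp_rw [mul_neg, Finset.sum_neg_distrib]
    linarith
  have h := lawMean_lawAt_le_of_step_le hP hlamle hstep (μ := Pi.single x 1) (fun a => by
    by_cases ha : a = x
    · subst ha; rw [Pi.single_eq_same]; norm_num
    · rw [Pi.single_eq_of_ne ha]) n
  have hneg : ∀ μ' : (Fin (K + 1) → S) → ℝ, lawMean μ' (fun z => -Ψ z) = -lawMean μ' Ψ := fun μ' => by
    unfold lawMean; rw [← Finset.sum_neg_distrib]; exact sum_congr rfl fun z _ => by ring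
  rw [hneg, hneg, lawMean_single] at h
  linarith

end Survival

end Summit.Ventures.LatticeQCDFlow.Scaling

end
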